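import Summits.Ventures.HSemireg.MarkmanKappaShape
import Summits.Ventures.HSemireg.AmplificationChainAssembly
import HarnessLib

/-!
# Venture HSemireg — Markman's class statement ON THE WHOLE SPLIT COMPONENT, with its printed hypotheses, read through
# the door-agnostic assembly (`AmplificationChainAssembly.lean`): adapters `IsMarkmanKappaShape ∧ object clause ⟹ seed`

HONEST FRAMING. Lean index of the computation cell `pub-hsemireg` (seat p5); proof-only companion of
`MarkmanClassStatement.lean` (the printed passages and the POINTWISE class statement) and `MarkmanKappaShape.lean` (the
class-side predicate). Nothing about any explicit variety is asserted; every published input is a hypothesis BY NAME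
(`weilFamilyReach_hyperbolic`, the assembly's `LocalVariationalHodgeFor 𝒪`) or BY VALUE (the anchor data and the seed's
class shape); nothing here says HC, HC_CM or HC_AV is proved. The theorems re-derive, for the SPLIT `ℚ(√-d)`-Weil component,
a case that is a THEOREM in print — for fourfolds [Markman2023GeneralizedKummers] Thm. 1.5 (= Thm. 13.4), p. 236, AS PRINTED in
J. Eur. Math. Soc. 25 (2023) («Theorem 1.5 (Theorem 13.4). Let `(A,K,h)` be a polarized abelian fourfold of Weil type of discriminant
`1`. The `3`-dimensional subspace of `H^{2,2}(A,ℚ)` spanned by `h²` and `∧⁴_K H¹(A,ℚ)` consists of algebraic classes. In particular, the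
Hodge conjecture holds for the generic such `(A,K,h)`.»; = «Theorem 1.3» of the pre-publication arXiv:1805.11574 text held in the
corpus — the published «Proposition 1.3 (Proposition 10.2)», p. 234, is a monodromy statement; discriminant `1 = (-1)²` = the split
component), the 2025 preprints supplying the METHOD ([Mar25b] §4) and its sixfold instance ([Mar25] Thm. 1.5.1, discriminant
`-1 = (-1)³`); 0 `sorry`, 0 definitions, 0 new named facts.

## The printed statement and its hypotheses, name by name ([Mar25b] = arXiv:2509.23403 §4; [Mar25] = arXiv:2502.03415 v2)

«Construct a coherent sheaf `E` over `X×X̂` of non-zero rank `r` satisfying: (a) `E` is semi-regular. (b) The class `κ(E)`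
remains of Hodge type under all deformations of `(X×X̂,η,h)` as a polarized abelian variety of Weil type. (c) The class
`κ_{d/2}(E)` does not belong to the image of `Sym^{d/2}(𝒜²)`. Conditions (2a) and (2b) and the Semi-regularity theorem imply
that `κ(E)` remains algebraic on every polarized abelian variety of Weil type `(A,η′,h′)` in the connected component of
moduli containing `(X×X̂,η,h)`. […] Hence every class in `HW(A,η′)` is algebraic.» In the tree's vocabulary (`K = ℚ(√-d)`):

* the anchor `(X×X̂, η, h)` ↦ `(P, ψ₀, h)` with `ψ₀ ≫ ψ₀ = -d`, `h` Markman's invariant polarization with `ψ₀^*h = d·h`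
  ([Mar25] §1.3 «`η(k)` maps `h` to `Nm(k)h`») and a projective embedding `ι` with hyperplane class `ι^*a = m·h`; the
  component is the SPLIT one (`IsHyperbolicWeilType P ψ₀ N h`: [Mar25] Lemma 3.1.3 «Then the discriminant of the hermitian
  form `H` is `(-1)ⁿ`», under its hypothesis «Assume that the similarity `f : V_ℚ → V_ℚ` … is defined in terms of the oriented
  plane `P`»; van Geemen 5.2/5.4);
* (a) + «the object» ↦ the assembly's object clause `𝒪 (2N) P.X I κ` for an object class `𝒪 : ObjClass` (sheaf door:
  `bfSheafClass`; route (C)'s perfect complex: the class typed by the cell's other seats), and «the Semi-regularity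
  theorem» ↦ `LocalVariationalHodgeFor 𝒪` (BF Thm. 5.1 for sheaves = `localVariationalHodgeFor_bfSheafClass`; Pridham /
  Perry for complexes, typed elsewhere) — hypotheses BY NAME;
* (b) + (c) ↦ `IsMarkmanKappaShape N d P ψ₀ h I κ w` ([Mar25] Cor. 1.3.2 + Lemma 2.2.7 / Cor. 4.0.4 + Thm. 1.4.1(4));
* «every `(A,η′,h′)` in the connected component of moduli» ↦ every hyperbolic `(A, φ, h_K)` of the same `(N, d)`, reached by
  Deligne's polarized family `weilFamilyReach_hyperbolic` (refereed named fact; [Mar25] §1.1: «the triple `(n, K, det H)` …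
  determines [the component] up to isogenies»), conclusion `Stubs.WeilAlgebraicSplitHyperplane N d`;
* «countable union of closed algebraic susbsets [Vo, Sec. 4.2]» ([Mar25] v2 p. 88, lines 35–38, misprint as printed) + «`K` acts via algebraic correspondences, `HW` 1-dimensional over
  `K`» ↦ inside the tree engine `weilClasses_algebraic_hyperbolic_of_localAnchor` (Baire / Charles–Schnell, Lefschetz
  (1,1), one class suffices, isogeny) which the assembly invokes.

Contents: `IsMarkmanKappaShape.hasSeedOn` (shape ∧ `n ∈ I` ∧ object clause ⟹ `HasSeedOn 𝒪 n P h w`),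
`IsMarkmanKappaShape.hasHyperbolicSeedOn` (on a split anchor, in the symmetrised class), the round trip
`hasHyperbolicSeedOn_iff_exists_isMarkmanKappaShape` (the predicate IS the class side of the seed), `….hasHyperbolicSeedOn_of_polarization`
(the same with the certificate stated in Markman's `h`: `ι^*a = m·h`, `ψ₀^*h = d·h`, hyperbolic for `h`), and the component-level
readings `splitHyperplane_of_reach_of_localVariationalHodgeFor_of_isMarkmanKappaShape` (any `N ≥ 1`),
`weilFourfoldsSplit_of_reach_of_localVariationalHodgeFor_of_isMarkmanKappaShape` (g = 4: the JEMS Thm. 1.5 component) and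
`weilSixfoldsSplit_of_reach_of_localVariationalHodgeFor_of_isMarkmanKappaShape` with its member-by-member reading
`weilClassesOf_sixfold_le_algebraicClasses_of_reach_of_localVariationalHodgeFor_of_isMarkmanKappaShape` (g = 6: [Mar25] Thm. 1.5.1
AS PRINTED — discriminant `-1` = split — as a CONDITIONAL statement, preprint).

References: [Markman2025SurveySecant] arXiv:2509.23403 §4 — a SURVEY, published: Proc. ICM 2026 Vol. 3 (SIAM, 2026) pp. 586–602,
bib `Markman2026ICMSecant` (SIAM pagination/numbering not verified against the arXiv text quoted here); the RESULTS it reports are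
proved in [Markman2025SecantWeil], a PREPRINT; [Markman2025SecantWeil] arXiv:2502.03415 v2 §1.1, §1.3,
Cor. 1.3.2, Thm. 1.4.1, Lemma 2.2.7, Lemma 3.1.3, Cor. 4.0.4 (public v2 numbering; «Cor. 4.0.7» in the held e-print rendering),
§1.5 / Thm. 1.5.1 and its proof p. 88 (preprint); [Markman2023GeneralizedKummers] J. Eur. Math. Soc. 25 (2023) 231–321, Thm. 1.5
(= Thm. 13.4), p. 236 (published numbering, read on the EMS Press text; = Thm. 1.3 of the pre-publication arXiv:1805.11574 text held
in the corpus, whose wording lacks the «In particular» sentence) — the split (discriminant `1`) fourfold statement in print;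
[Markman2023GeneralizedKummers] Prop. 1.3 (= Prop. 10.2), p. 234, as published, is a MONODROMY statement; [Deligne1982HodgeCycles] proof of Thm. 4.8;
[vanGeemen1994HodgeAV] 5.2–5.4, proof of Thm. 6.12; [BuchweitzFlenner2003] Thm. 5.1.
-/

noncomputable section

open CategoryTheory AlgebraicGeometry

namespace Summit.Ventures.HSemireg

open Literature.AlgebraicGeometry Literature.AlgebraicGeometry.Motives
open Literature.AlgebraicGeometry.HodgeTheory
open Literature.AlgebraicTopology.SingularHomology

/-! ## Shape ∧ object clause ⟹ the assembly's seed -/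

section Seeds

variable {𝒪 : ObjClass} {n d : ℕ} {P : AbelianVariety ℂ} {ψ₀ : P ⟶ P} {h : complexBetti P.X 2} {I : Finset ℕ}
  {κ : (p : ℕ) → complexBetti P.X (2 * p)} {w : complexBetti P.X (2 * n)}

/-- **Markman's class hypothesis ∧ an admissible object with these classes ⟹ a seed of class `𝒪` for `q·hⁿ + w` on `P`**
(the assembly's `HasSeedOn`; `n ∈ I`: the semiregularity theorem controls the middle degree).
[cite: Markman2025SurveySecant, §4 conditions (a)–(c)] -/
theorem IsMarkmanKappaShape.hasSeedOn (hS : IsMarkmanKappaShape n d P ψ₀ h I κ w) (hnI : n ∈ I)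
    (h𝒪 : 𝒪 (2 * n) P.X I κ) : HasSeedOn 𝒪 n P h w := by
  obtain ⟨-, -, -, q, c, hκn, hκp⟩ := hS
  exact ⟨I, κ, q, c, hnI, h𝒪, hκn, hκp⟩

end Seeds

/-! ## On a split anchor: the hyperbolic seed, in the symmetrised class and in Markman's polarization -/

section Hyperbolic

open Summit.HodgeConjecture.HodgeConjecture
open Summit.HodgeConjecture.HodgeConjecture.Cruxes.HodgeAbelianVarieties.EStepSecantInduction

/-- **A hyperbolic seed of class `𝒪` from Markman's class hypothesis stated in the tree's symmetrised class** `h_K =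
symmetrisedClass d P ψ₀ ι a`: anchor `(P, ψ₀, ι, a)` of dimension `2N` with `ψ₀² = -d`, split for `h_K`, shape
`IsMarkmanKappaShape N d P ψ₀ h_K I κ w`, `N ∈ I`, and an admissible object `𝒪 (2N) P.X I κ`.
[cite: Markman2025SurveySecant, §4] [cite: vanGeemen1994HodgeAV, Lemma 5.2 and 5.4] -/
theorem IsMarkmanKappaShape.hasHyperbolicSeedOn {𝒪 : ObjClass} {N d : ℕ} (P : AbelianVariety ℂ) (ψ₀ : P ⟶ P)
    (ι : ProjectiveEmbedding P.X) (a : complexBetti (projectiveSpace ι.n ℂ) 2) (hP : P.dim = 2 * N)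
    (hψ : ψ₀ ≫ ψ₀ = -(d • 𝟙 P)) (ha : IsRationalClass a) (ha0 : a ≠ 0)
    (hhyp : IsHyperbolicWeilType P ψ₀ N (symmetrisedClass d P ψ₀ ι a)) {I : Finset ℕ}
    {κ : (p : ℕ) → complexBetti P.X (2 * p)} {w : complexBetti P.X (2 * N)}
    (hS : IsMarkmanKappaShape N d P ψ₀ (symmetrisedClass d P ψ₀ ι a) I κ w) (hNI : N ∈ I)
    (h𝒪 : 𝒪 (2 * N) P.X I κ) : HasHyperbolicSeedOn 𝒪 N d :=
  ⟨P, ψ₀, ι, a, w, hP, hψ, ha, ha0, hhyp, hS.mem_weilClassesOf, hS.isRationalClass, hS.ne_zero, hS.hasSeedOn hNI h𝒪⟩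

/-- **Round trip: the assembly's hyperbolic seed IS «anchor ∧ Markman class hypothesis (in the symmetrised class) ∧ `N ∈ I` ∧
object clause»** — `IsMarkmanKappaShape` is exactly the class side of `HasHyperbolicSeedOn` (sanity check of the split between the
class typer and the assembly; both directions are binder shuffles). [cite: Markman2025SurveySecant, §4 conditions (a)–(c)] -/
theorem hasHyperbolicSeedOn_iff_exists_isMarkmanKappaShape {𝒪 : ObjClass} {N d : ℕ} :
    HasHyperbolicSeedOn 𝒪 N d ↔
      ∃ (P : AbelianVariety ℂ) (ψ₀ : P ⟶ P) (ι : ProjectiveEmbedding P.X) (a : complexBetti (projectiveSpace ι.n ℂ) 2)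
        (I : Finset ℕ) (κ : (p : ℕ) → complexBetti P.X (2 * p)) (w : complexBetti P.X (2 * N)),
        P.dim = 2 * N ∧ ψ₀ ≫ ψ₀ = -(d • 𝟙 P) ∧ IsRationalClass a ∧ a ≠ 0 ∧
        IsHyperbolicWeilType P ψ₀ N (symmetrisedClass d P ψ₀ ι a) ∧
        IsMarkmanKappaShape N d P ψ₀ (symmetrisedClass d P ψ₀ ι a) I κ w ∧ N ∈ I ∧ 𝒪 (2 * N) P.X I κ := by
  constructor
  · rintro ⟨P, ψ₀, ι, a, w, hP, hψ, ha, ha0, hhyp, hwW, hwr, hw0, I, κ, q, c, hNI, h𝒪, hκn, hκp⟩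
    exact ⟨P, ψ₀, ι, a, I, κ, w, hP, hψ, ha, ha0, hhyp, ⟨hwW, hwr, hw0, q, c, hκn, hκp⟩, hNI, h𝒪⟩
  · rintro ⟨P, ψ₀, ι, a, I, κ, w, hP, hψ, ha, ha0, hhyp, hS, hNI, h𝒪⟩
    exact hS.hasHyperbolicSeedOn P ψ₀ ι a hP hψ ha ha0 hhyp hNI h𝒪

/-- **The same with the certificate in MARKMAN'S POLARIZATION `h`** (how a census row (I3)+(I4) enters): `ι^*a = m·h`
(`m ∈ ℚ^×`), `ψ₀^*h = d·h` ([Mar25] §1.3), `(P, ψ₀)` split for `h` ([Mar25] Lemma 3.1.3 / the row's isotropic `K`-subspace),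
shape `IsMarkmanKappaShape N d P ψ₀ h I κ w`, `N ∈ I`, object clause ⟹ `HasHyperbolicSeedOn 𝒪 N d` (the symmetrised class is
`2dm·h`; shape and hyperbolicity are insensitive to the rescaling). [cite: Markman2025SecantWeil, §1.3 and Lemma 3.1.3]
[cite: Markman2025SurveySecant, §4] -/
theorem IsMarkmanKappaShape.hasHyperbolicSeedOn_of_polarization {𝒪 : ObjClass} {N d : ℕ} (hd : 0 < d)
    (P : AbelianVariety ℂ) (ψ₀ : P ⟶ P) (ι : ProjectiveEmbedding P.X) (a : complexBetti (projectiveSpace ι.n ℂ) 2)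
    (hP : P.dim = 2 * N) (hψ : ψ₀ ≫ ψ₀ = -(d • 𝟙 P)) (ha : IsRationalClass a) (ha0 : a ≠ 0) {h : complexBetti P.X 2}
    {m : ℚ} (hm : m ≠ 0) (hι : complexBetti.map ι.ι 2 a = ((m : ℚ) : ℂ) • h)
    (hψh : complexBetti.map ψ₀.hom.hom.hom 2 h = (d : ℂ) • h) (hhyp : IsHyperbolicWeilType P ψ₀ N h) {I : Finset ℕ}
    {κ : (p : ℕ) → complexBetti P.X (2 * p)} {w : complexBetti P.X (2 * N)} (hS : IsMarkmanKappaShape N d P ψ₀ h I κ w)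
    (hNI : N ∈ I) (h𝒪 : 𝒪 (2 * N) P.X I κ) : HasHyperbolicSeedOn 𝒪 N d := by
  refine (hS.symmetrised hd ι a hm hι hψh).hasHyperbolicSeedOn P ψ₀ ι a hP hψ ha ha0 ?_ hNI h𝒪
  rw [symmetrisedClass_eq_smul_of_map_eq ι a hι hψh]
  have hd' : (d : ℚ) ≠ 0 := by exact_mod_cast hd.ne'
  have hc : (((2 * d * m : ℚ)) : ℂ) ≠ 0 := by exact_mod_cast mul_ne_zero (mul_ne_zero two_ne_zero hd') hm
  exact (isHyperbolicWeilType_smul_iff hc).2 hhyp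

/-! ## Markman's class statement on the whole split component -/

/-- **MARKMAN'S CLASS STATEMENT, component level, with its printed hypotheses ([Mar25b] §4), for `K = ℚ(√-d)` and the SPLIT
component, any half-dimension `N ≥ 1`.** GIVEN: Deligne's hyperbolic reach `weilFamilyReach_hyperbolic` («every `(A,η′,h′)` in
the connected component»); «the Semi-regularity theorem» for the object class `𝒪` (`LocalVariationalHodgeFor 𝒪`); an anchor
`(P, ψ₀)` of dimension `2N`, `ψ₀² = -d`, with Markman's polarization `h` (`ψ₀^*h = d·h`, a projective embedding with `ι^*a =
m·h`, `m ≠ 0`), SPLIT for `h`; an admissible (semiregular) object, `𝒪 (2N) P.X I κ` with `N ∈ I` (condition (a)); and the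
class hypothesis `IsMarkmanKappaShape N d P ψ₀ h I κ w` (conditions (b)+(c)). THEN the Weil classes of EVERY split
`√-d`-Weil abelian `2N`-fold are algebraic (`Stubs.WeilAlgebraicSplitHyperplane N d`). Proof: the assembly's
`splitHyperplane_of_reach_of_localVariationalHodgeFor_of_hyperbolicSeedOn` on the seed of
`hasHyperbolicSeedOn_of_polarization`. In print the conclusion is a theorem for `N = 2` ([Markman2023GeneralizedKummers]
Thm. 1.5 (= Thm. 13.4), J. Eur. Math. Soc. 25 (2023) p. 236 (Thm. 1.3 in the pre-publication arXiv:1805.11574 numbering),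
discriminant `1`) and for `N = 3` ([Mar25] Thm. 1.5.1, discriminant `-1`, preprint — the method's sixfold instance);
for `N ≥ 4` nothing is in print and nothing beyond the implication is claimed. Decides nothing by itself.
[cite: Markman2025SurveySecant, §4] [cite: Markman2025SecantWeil, proof of Thm. 1.5.1 (v2 p. 88; the method, preprint)]
[cite: Markman2026ICMSecant, §4 of the arXiv text (published ICM 2026 survey reporting it; proof = Markman2025SecantWeil, preprint)]
[cite: Markman2023GeneralizedKummers, Thm. 1.5 (= Thm. 13.4), p. 236 (the case N = 2 in print; arXiv:1805.11574 pre-publication numbering: Thm. 1.3)]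
[cite: Deligne1982HodgeCycles, proof of Thm. 4.8] -/
theorem splitHyperplane_of_reach_of_localVariationalHodgeFor_of_isMarkmanKappaShape (hF : weilFamilyReach_hyperbolic)
    {𝒪 : ObjClass} (hT : LocalVariationalHodgeFor 𝒪) {N d : ℕ} (hN : 1 ≤ N) (hd : 0 < d) (P : AbelianVariety ℂ)
    (ψ₀ : P ⟶ P) (ι : ProjectiveEmbedding P.X) (a : complexBetti (projectiveSpace ι.n ℂ) 2) (hP : P.dim = 2 * N)
    (hψ : ψ₀ ≫ ψ₀ = -(d • 𝟙 P)) (ha : IsRationalClass a) (ha0 : a ≠ 0) {h : complexBetti P.X 2} {m : ℚ} (hm : m ≠ 0)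
    (hι : complexBetti.map ι.ι 2 a = ((m : ℚ) : ℂ) • h) (hψh : complexBetti.map ψ₀.hom.hom.hom 2 h = (d : ℂ) • h)
    (hhyp : IsHyperbolicWeilType P ψ₀ N h) {I : Finset ℕ} {κ : (p : ℕ) → complexBetti P.X (2 * p)}
    {w : complexBetti P.X (2 * N)} (hS : IsMarkmanKappaShape N d P ψ₀ h I κ w) (hNI : N ∈ I)
    (h𝒪 : 𝒪 (2 * N) P.X I κ) : Stubs.WeilAlgebraicSplitHyperplane N d :=
  splitHyperplane_of_reach_of_localVariationalHodgeFor_of_hyperbolicSeedOn hF hN hd hT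
    (hS.hasHyperbolicSeedOn_of_polarization hd P ψ₀ ι a hP hψ ha ha0 hm hι hψh hhyp hNI h𝒪)

/-- **g = 4: Markman's class statement for split `ℚ(√-d)`-Weil abelian FOURFOLDS** (the cell's STEP-0 component shape:
anchor `P = X × X̂`, `X = E × E` with CM, `ψ₀ = η_B(√-d)`, `h = h_B`; object = route (C)'s perfect complex via its class `𝒪`
and transfer Prop; class hypothesis = census (I3): `ch₂ = q·h² + w`, `w ≠ 0` rational Weil, `ch_p ∈ ℚ·hᵖ` else — all BY
VALUE / BY NAME, nothing asserted). Conclusion `Stubs.WeilAlgebraicSplitHyperplane 2 d`: every split `√-d`-Weil abelian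
fourfold has algebraic Weil classes — the Weil-plane part of a theorem IN PRINT, re-derived modulo the named hypotheses:
[Markman2023GeneralizedKummers] J. Eur. Math. Soc. 25 (2023) p. 236, AS PRINTED: «Theorem 1.5 (Theorem 13.4). Let `(A,K,h)` be a
polarized abelian fourfold of Weil type of discriminant `1`. The `3`-dimensional subspace of `H^{2,2}(A,ℚ)` spanned by `h²` and
`∧⁴_K H¹(A,ℚ)` consists of algebraic classes. In particular, the Hodge conjecture holds for the generic such `(A,K,h)`.» (= «Theorem
1.3» of the pre-publication arXiv:1805.11574 text, which lacks the last sentence; only the first sentence's Weil-plane part is re-derived;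
discriminant `1 = (-1)²` is the split component, [Mar25] Lemma 3.1.3). [Mar25] Thm. 1.5.1 (sixfolds, discriminant `-1`) is the METHOD's
printed instance, not this statement, and [Mar25] Cor. 1.6.1 («The Hodge conjecture holds for abelian fourfolds») is STRONGER than
anything re-derived here — neither is claimed.
[cite: Markman2023GeneralizedKummers, Thm. 1.5 (= Thm. 13.4), p. 236 (the split fourfold case in print; arXiv:1805.11574 pre-publication numbering: Thm. 1.3)]
[cite: Markman2025SurveySecant, §4] [cite: Markman2025SecantWeil, §1.5 (the method; Thm. 1.5.1 is its sixfold instance; preprint)]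
[cite: Markman2026ICMSecant, §4 of the arXiv text (published ICM 2026 survey; results preprint)]
[cite: Deligne1982HodgeCycles, proof of Thm. 4.8] -/
theorem weilFourfoldsSplit_of_reach_of_localVariationalHodgeFor_of_isMarkmanKappaShape (hF : weilFamilyReach_hyperbolic)
    {𝒪 : ObjClass} (hT : LocalVariationalHodgeFor 𝒪) {d : ℕ} (hd : 0 < d) (P : AbelianVariety ℂ) (ψ₀ : P ⟶ P)
    (ι : ProjectiveEmbedding P.X) (a : complexBetti (projectiveSpace ι.n ℂ) 2) (hP : P.dim = 2 * 2)
    (hψ : ψ₀ ≫ ψ₀ = -(d • 𝟙 P)) (ha : IsRationalClass a) (ha0 : a ≠ 0) {h : complexBetti P.X 2} {m : ℚ} (hm : m ≠ 0)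
    (hι : complexBetti.map ι.ι 2 a = ((m : ℚ) : ℂ) • h) (hψh : complexBetti.map ψ₀.hom.hom.hom 2 h = (d : ℂ) • h)
    (hhyp : IsHyperbolicWeilType P ψ₀ 2 h) {I : Finset ℕ} {κ : (p : ℕ) → complexBetti P.X (2 * p)}
    {w : complexBetti P.X (2 * 2)} (hS : IsMarkmanKappaShape 2 d P ψ₀ h I κ w) (h2I : 2 ∈ I)
    (h𝒪 : 𝒪 (2 * 2) P.X I κ) : Stubs.WeilAlgebraicSplitHyperplane 2 d :=
  splitHyperplane_of_reach_of_localVariationalHodgeFor_of_isMarkmanKappaShape hF hT (by norm_num) hd P ψ₀ ι a hP hψ ha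
    ha0 hm hι hψh hhyp hS h2I h𝒪

end Hyperbolic

/-! ## g = 6 — the method's printed sixfold instance: [Mar25] Thm. 1.5.1 AS PRINTED, as a conditional statement

Printed ([Mar25] = arXiv:2502.03415 v2, §1.5, Theorem 1.5.1 — PDF p. 9, lines 7–13 of the v2 text layer; the «p. 7» of this file's earlier
versions was the held corpus chunk number): «Theorem 1.5.1. Let `d` be a positive integer. Set `K := ℚ(√-d)`. The Hodge-Weil
classes of polarized abelian sixfolds of Weil type with complex multiplication by `K` and with discriminant `-1` are algebraic.»
Dictionary: «discriminant `-1`» = `(-1)³` = the SPLIT (hyperbolic) sixfold component — [Mar25] Lemma 3.1.3 «Then the discriminant of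
the hermitian form `H` is `(-1)ⁿ`» (under its hypothesis on the oriented plane `P`) and the tree's `IsHyperbolicWeilType A φ 3 h_K`
(van Geemen 5.2/5.4: hyperbolic ⟺ `det H = (-1)ⁿ`); «the Hodge-Weil classes … are algebraic» on that component = the registered
predicate `Stubs.WeilAlgebraicSplitHyperplane 3 d` (Weil plane `weilClassesOf A φ 3 d ≤ algebraicClasses A.X 3` for every split
member; the predicate itself is tagged Thm. 1.5.1 in the tree). The printed proof runs: semiregular (twisted) reflexive sheaf `𝓑` on
the quotient `Y` with `κ(𝓔) = q^*κ(𝓑)` (§1.5) + «Our verification of Conjecture […] in the case of abelian varieties implies that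
`(Y,𝓑)` deforms locally over the locus where `κ(𝓑)` remains of Hodge-type» + Cor. 1.3.2 + Thm. 1.4.1 («The `η(K)`-translates of the
graded summand `κ₃(𝓔)` of `κ(𝓔)` in `H^{3,3}(X×X̂,ℚ)`, together with `h³`, span the `3`-dimensional subspace
`ℚh³ ⊕ ĤW_P`») + the spreading of p. 88. Below, EVERY one of these inputs is a hypothesis BY NAME (`weilFamilyReach_hyperbolic`,
`LocalVariationalHodgeFor 𝒪` — the printed transfer for twisted sheaves is the preprint's own Conjecture verified there for abelian
varieties, NOT a refereed theorem; for untwisted sheaves it is BF Thm. 5.1) or BY VALUE (the anchor, `IsMarkmanKappaShape 3 d …`,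
the object clause); NOTHING about Markman's `𝓔`, `𝓑`, the genus-3 Jacobian or any explicit sixfold is asserted, and the cell's
split-sixfold census rows are intended witnesses by value only. A PREPRINT theorem re-derived modulo its named hypotheses; decides
nothing by itself. -/

section Sixfolds

open Summit.HodgeConjecture.HodgeConjecture
open Summit.HodgeConjecture.HodgeConjecture.Cruxes.HodgeAbelianVarieties.EStepSecantInduction
open Summit.HodgeConjecture.HodgeConjecture.WeilTypeLadder

/-- **g = 6: [Mar25] Thm. 1.5.1 for `K = ℚ(√-d)`, CONDITIONAL form in the tree's currency.** GIVEN Deligne's hyperbolic reach,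
«the Semi-regularity theorem» for the object class `𝒪` (`LocalVariationalHodgeFor 𝒪`, BY NAME), an anchor `(P, ψ₀)` of dimension
`6` with `ψ₀² = -d`, Markman's polarization `h` (`ψ₀^*h = d·h`, `ι^*a = m·h`, `m ≠ 0`), SPLIT for `h` (= discriminant `-1`), an
admissible object `𝒪 6 P.X I κ` with `3 ∈ I`, and the class hypothesis `IsMarkmanKappaShape 3 d P ψ₀ h I κ w` (Cor. 1.3.2 +
Thm. 1.4.1: `κ₃ = q·h³ + w`, `w ≠ 0` rational Hodge–Weil, `κ_p ∈ ℚ·hᵖ` else) THEN «the Hodge-Weil classes of polarized abelian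
sixfolds of Weil type with complex multiplication by `K` and with discriminant `-1` are algebraic» — in the REGISTERED PREDICATE'S
rendering of that printed sentence, `Stubs.WeilAlgebraicSplitHyperplane 3 d` (the dictionary «polarized sixfold of discriminant `-1`» =
«hyperbolic member for a rational-hyperplane `h_K = d·e^*a + φ^*e^*a`» is carried by that predicate's own Thm. 1.5.1 tag and by the
section docstring above ([Mar25] Lemma 3.1.3; van Geemen 5.2/5.4); it is not re-proved here). Instance `N = 3` of
`splitHyperplane_of_reach_of_localVariationalHodgeFor_of_isMarkmanKappaShape`; preprint statement, re-derived modulo the named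
hypotheses; nothing asserted about any explicit sixfold. [cite: Markman2025SecantWeil, Thm. 1.5.1, §1.5 and Thm. 1.4.1 (preprint)]
[cite: Markman2025SurveySecant, §4] [cite: Deligne1982HodgeCycles, proof of Thm. 4.8] -/
theorem weilSixfoldsSplit_of_reach_of_localVariationalHodgeFor_of_isMarkmanKappaShape (hF : weilFamilyReach_hyperbolic)
    {𝒪 : ObjClass} (hT : LocalVariationalHodgeFor 𝒪) {d : ℕ} (hd : 0 < d) (P : AbelianVariety ℂ) (ψ₀ : P ⟶ P)
    (ι : ProjectiveEmbedding P.X) (a : complexBetti (projectiveSpace ι.n ℂ) 2) (hP : P.dim = 2 * 3)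
    (hψ : ψ₀ ≫ ψ₀ = -(d • 𝟙 P)) (ha : IsRationalClass a) (ha0 : a ≠ 0) {h : complexBetti P.X 2} {m : ℚ} (hm : m ≠ 0)
    (hι : complexBetti.map ι.ι 2 a = ((m : ℚ) : ℂ) • h) (hψh : complexBetti.map ψ₀.hom.hom.hom 2 h = (d : ℂ) • h)
    (hhyp : IsHyperbolicWeilType P ψ₀ 3 h) {I : Finset ℕ} {κ : (p : ℕ) → complexBetti P.X (2 * p)}
    {w : complexBetti P.X (2 * 3)} (hS : IsMarkmanKappaShape 3 d P ψ₀ h I κ w) (h3I : 3 ∈ I)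
    (h𝒪 : 𝒪 (2 * 3) P.X I κ) : Stubs.WeilAlgebraicSplitHyperplane 3 d :=
  splitHyperplane_of_reach_of_localVariationalHodgeFor_of_isMarkmanKappaShape hF hT (by norm_num) hd P ψ₀ ι a hP hψ ha
    ha0 hm hι hψh hhyp hS h3I h𝒪

/-- **g = 6, unfolded reading** (the printed sentence member by member): under the hypotheses of
`weilSixfoldsSplit_of_reach_of_localVariationalHodgeFor_of_isMarkmanKappaShape`, for every complex abelian SIXFOLD `A` with
`φ ≫ φ = -(d • 𝟙 A)`, every projective embedding `e_A` and rational `a_A ≠ 0` such that `(A, φ)` is of hyperbolic (= discriminant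
`-1`) Weil type for `h_K = d·e_A^*a_A + φ^*e_A^*a_A`, the whole Hodge–Weil plane `weilClassesOf A φ 3 d ⊆ H⁶(A(ℂ); ℂ)`
consists of algebraic classes — via the tree engine `weilClasses_algebraic_hyperbolic_of_localAnchor` on the anchor delivered by
the assembly.
[cite: Markman2025SecantWeil, Thm. 1.5.1 (preprint; statement re-derived modulo named hypotheses)]
[cite: Deligne1982HodgeCycles, proof of Thm. 4.8] [cite: vanGeemen1994HodgeAV, proof of Thm. 6.12] -/
theorem weilClassesOf_sixfold_le_algebraicClasses_of_reach_of_localVariationalHodgeFor_of_isMarkmanKappaShape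
    (hF : weilFamilyReach_hyperbolic) {𝒪 : ObjClass} (hT : LocalVariationalHodgeFor 𝒪) {d : ℕ} (hd : 0 < d)
    (P : AbelianVariety ℂ) (ψ₀ : P ⟶ P) (ι : ProjectiveEmbedding P.X) (a : complexBetti (projectiveSpace ι.n ℂ) 2)
    (hP : P.dim = 2 * 3) (hψ : ψ₀ ≫ ψ₀ = -(d • 𝟙 P)) (ha : IsRationalClass a) (ha0 : a ≠ 0) {h : complexBetti P.X 2}
    {m : ℚ} (hm : m ≠ 0) (hι : complexBetti.map ι.ι 2 a = ((m : ℚ) : ℂ) • h)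
    (hψh : complexBetti.map ψ₀.hom.hom.hom 2 h = (d : ℂ) • h) (hhyp : IsHyperbolicWeilType P ψ₀ 3 h) {I : Finset ℕ}
    {κ : (p : ℕ) → complexBetti P.X (2 * p)} {w : complexBetti P.X (2 * 3)} (hS : IsMarkmanKappaShape 3 d P ψ₀ h I κ w)
    (h3I : 3 ∈ I) (h𝒪 : 𝒪 (2 * 3) P.X I κ) (A : AbelianVariety ℂ) (φ : A ⟶ A) (hA : A.dim = 2 * 3)
    (hφ : φ ≫ φ = -(d • 𝟙 A)) (eA : ProjectiveEmbedding A.X) (aA : complexBetti (projectiveSpace eA.n ℂ) 2)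
    (haA : IsRationalClass aA) (haA0 : aA ≠ 0)
    (hhypA : IsHyperbolicWeilType A φ 3
      ((d : ℂ) • complexBetti.map eA.ι 2 aA + complexBetti.map φ.hom.hom.hom 2 (complexBetti.map eA.ι 2 aA))) :
    weilClassesOf A φ 3 d ≤ algebraicClasses A.X 3 :=
  weilClasses_algebraic_hyperbolic_of_localAnchor 3 d (by norm_num) hd
    (hasLocallyAlgebraicWeilAnchor_of_localVariationalHodgeFor_of_hyperbolicSeedOn hT
      (hS.hasHyperbolicSeedOn_of_polarization hd P ψ₀ ι a hP hψ ha ha0 hm hι hψh hhyp h3I h𝒪))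
    hF A φ hA hφ eA aA haA haA0 hhypA

end Sixfolds

end Summit.Ventures.HSemireg

end
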